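import Summits.QuantumFields.GaugeBoot.FluctuationWickEquation
import Summits.QuantumFields.GaugeBoot.FluctuationHafnianLeibniz
import HarnessLib

/-!
# Fluctuations of Wilson loops, XVIII: Wick's formula for the leading coefficients (gauge-boot, ADDENDUM 33 part D)

HONEST FRAMING (cell `pub-gaugeboot`, page 1 of every file): the venture produces certified bounds
on lattice expectations at stated coupling, gauge group, dimension and torus size; NOT a mass gap,
NOT a continuum limit, NOT a string tension; NOT Yang–Mills-summit-bearing (barriers
`FixedCouplingUltralocality`, `PerturbativeInvisibility`).  Strong-coupling `SO(N)` lattice gauge theory with free boundary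
condition (S. Chatterjee, Comm. Math. Phys. **366** (2019); S. Chatterjee, J. Jafarov, arXiv:1604.04777); nothing about
four-dimensional continuum Yang–Mills or a mass gap.

## Content

★★ `centered_coeff_wick`: in the setting of `centered_coeff_vanish` (`K ≥ 2`), the leading coefficient of the power-series
centered block product FACTORISES AND PAIRS UP:
`coeff_m G(B₀; C₁, …, C_m) = f₀(B₀) · Hf(C₁, …, C_m)`, where `Hf` is the hafnian (sum over perfect matchings of products over
matched pairs) of the limiting block covariance `κ̃(A, B) = coeff₂ G(∅; A, B)`.  Proof: strong induction on `m`; the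
difference `u_m − f₀ ⊗ Hf` solves the HOMOGENEOUS first-order block equation — the pair source of `u_m`
(`centered_coeff_leading_equation`, with `u_{m−2} = f₀ ⊗ Hf` by induction and the double-erasure form of the hafnian) equals the
slot operator applied to `f₀ ⊗ Hf` (zeroth-order loop equation on the `B₀` slot; `hafnian_slot_leibniz` plus
`centered_two_block_identity` on the centered slots) — and is exponentially bounded, so `block_contraction` kills it.
This is WICK'S RULE: the joint fluctuations of Wilson loops in the strongly coupled 't Hooft limit are GAUSSIAN at the level
of moments.

Everything here is `[new (lane)]` over the cited expansion.
-/

noncomputable section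

open Finset Filter Topology PowerSeries
open Literature.MathematicalPhysics.QuantumFieldTheory.Chatterjee2019LargeN
open Literature.MathematicalPhysics.QuantumFieldTheory.Chatterjee2019LargeN.Word

namespace Summit.QuantumFields.GaugeBoot

namespace StringDuality

variable {d : ℕ}

/-! ## List bookkeeping -/

/-- `get` as `getD`. [folklore] -/
theorem get_eq_getD' {α : Type*} (Cs : List α) (j : Fin Cs.length) (dflt : α) : Cs.get j = Cs.getD j dflt := by
  simp [List.getD_eq_getElem?_getD, j.isLt]

/-- Resetting an entry to itself. [folklore] -/
theorem set_getD_self' {α : Type*} (Cs : List α) {j : ℕ} (hj : j < Cs.length) (dflt : α) : Cs.set j (Cs.getD j dflt) = Cs := by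
  simp [List.getD_eq_getElem?_getD, hj]

/-- A positional sum is a list sum. [folklore] -/
theorem sum_range_getD {α : Type*} (f : α → ℕ) (dflt : α) :
    ∀ Cs : List α, ∑ i ∈ Finset.range Cs.length, f (Cs.getD i dflt) = (Cs.map f).sum := by
  intro Cs
  induction Cs with
  | nil => simp
  | cons C t ih =>
    rw [List.length_cons, Finset.sum_range_succ', List.map_cons, List.sum_cons]
    simp only [List.getD_cons_succ, List.getD_cons_zero, ih]
    ring

/-- Entries at positions below the length are members. [folklore] -/
theorem getD_mem' {α : Type*} (Cs : List α) {i : ℕ} (hi : i < Cs.length) (dflt : α) : Cs.getD i dflt ∈ Cs := by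
  simp [List.getD_eq_getElem?_getD, hi]

/-- A member sits at some position. [folklore] -/
theorem exists_getD_eq' {α : Type*} (Cs : List α) {x : α} (dflt : α) (h : x ∈ Cs) : ∃ i, i < Cs.length ∧ Cs.getD i dflt = x := by
  obtain ⟨i, hi, rfl⟩ := List.getElem_of_mem h
  exact ⟨i, hi, by simp [List.getD_eq_getElem?_getD, hi]⟩

/-! ## Wick's formula -/

section setting

variable {β : ℝ} {K : ℕ} {F : ℕ → ℝ → LoopSeq d → ℝ} {Cc Lc : ℝ} (hCc : 1 ≤ Cc) (hLc : 1 ≤ Lc)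
  (hF0 : ∀ u : LoopSeq d, F 0 β u = 0) (hF1 : ∀ u : LoopSeq d, F 1 β u = 0)
  (hrec : ∀ k, k ≤ K → ∀ s : LoopSeq d, IsLoopSeq s → s ≠ [] →
    (s.len : ℝ) * F (k + 2) β s -
        ((∑ o : InvIdx s, F (k + 2) β (s.negSplitAt o)) - (∑ o : SameIdx s, F (k + 2) β (s.posSplitAt o))
          + β * (∑ o : DeformIdx s, F (k + 2) β (s.negDeformAt o))
          - β * (∑ o : DeformIdx s, F (k + 2) β (s.posDeformAt o))) =
      (s.len : ℝ) * F (k + 1) β s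
        + ((∑ o : SameIdx s, F (k + 1) β (s.negTwistAt o)) - ∑ o : InvIdx s, F (k + 1) β (s.posTwistAt o))
        + ((∑ o : MergeIdx s, F k β (s.negMergeAt o)) - ∑ o : MergeIdx s, F k β (s.posMergeAt o)))
  (hperm : ∀ k, k ≤ K → ∀ s s' : LoopSeq d, IsLoopSeq s → s.Perm s' → F (k + 2) β s = F (k + 2) β s')
  (hnil : ∀ k, k ≤ K → F (k + 2) β [] = if k = 0 then 1 else 0)
  (hbd : ∀ j, j ≤ K → ∀ u : LoopSeq d, IsLoopSeq u → |F (j + 2) β u| ≤ Cc * Lc ^ u.len)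
  (hβ : |β| ≤ 1 / (4096 * ((d : ℝ) + 1) * (((1 + (K + 1) * Cc) * Lc) ^ 2 + 4) ^ 4))
  (P : LoopSeq d → PowerSeries ℝ) (hP : ∀ (u : LoopSeq d) (k : ℕ), coeff k (P u) = F (k + 2) β u)
  {G : LoopSeq d → List (LoopSeq d) → PowerSeries ℝ} (hG0 : ∀ B₀ : LoopSeq d, G B₀ [] = P B₀)
  (hGs : ∀ (B₀ C : LoopSeq d) (rest : List (LoopSeq d)), G B₀ (C :: rest) = G (B₀ ++ C) rest - P C * G B₀ rest)
  (hK2 : 2 ≤ K)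
  (κ : LoopSeq d → LoopSeq d → ℝ) (hκ : ∀ A B : LoopSeq d, κ A B = coeff 2 (G [] [A, B]))
  {Hf : List (LoopSeq d) → Finset ℕ → ℝ} (hH0 : ∀ Cs, Hf Cs ∅ = 1)
  (hHS : ∀ (Cs : List (LoopSeq d)) (S : Finset ℕ) (h : S.Nonempty), Hf Cs S =
    ∑ i ∈ S.erase (S.min' h), κ (Cs.getD (S.min' h) []) (Cs.getD i []) * Hf Cs ((S.erase (S.min' h)).erase i))
include hCc hLc hF0 hF1 hrec hperm hnil hbd hβ hP hG0 hGs hK2 hκ hH0 hHS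

/-- ★★ WICK'S FORMULA for the leading coefficients of centered block products: for `m ≤ K`, genuine `B₀` and genuine
blocks `C₁, …, C_m`, `coeff_m G(B₀; C₁, …, C_m) = f₀(B₀) · Hf(C₁, …, C_m)` — the hafnian of the limiting block
covariance `κ(A, B) = coeff₂ G(∅; A, B)`. [new (lane)] -/
theorem centered_coeff_wick : ∀ m, m ≤ K → ∀ (B₀ : LoopSeq d) (Cs : List (LoopSeq d)), IsLoopSeq B₀ →
    (∀ C ∈ Cs, IsLoopSeq C) → Cs.length = m → coeff m (G B₀ Cs) = F 2 β B₀ * Hf Cs (Finset.range m) := by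
  classical
  -- ### the real block operators and their linearity
  obtain ⟨SD, hSD⟩ : ∃ SD : LoopSeq d → (LoopSeq d → ℝ) → ℝ, ∀ A g, SD A g =
      ((∑ o : InvIdx A, g (A.negSplitAt o)) - ∑ o : SameIdx A, g (A.posSplitAt o))
        + β * ((∑ o : DeformIdx A, g (A.negDeformAt o)) - ∑ o : DeformIdx A, g (A.posDeformAt o)) := ⟨fun A g => _, fun _ _ => rfl⟩
  obtain ⟨XM, hXM⟩ : ∃ XM : LoopSeq d → LoopSeq d → (LoopSeq d → ℝ) → ℝ, ∀ A B g, XM A B g =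
      (∑ i : Fin A.length, ∑ j : Fin B.length,
          ∑ q : {xy : Fin (A.get i).length × Fin (B.get j).length // ((B.get j).get xy.2).1 = ((A.get i).get xy.1).1},
            (g (A.take i ++ LoopSeq.prune [Word.negMerge _ q.1.1 _ q.1.2] ++ A.drop (i + 1) ++ B.eraseIdx j)
              - g (A.take i ++ LoopSeq.prune [Word.posMerge _ q.1.1 _ q.1.2] ++ A.drop (i + 1) ++ B.eraseIdx j)))
      + ∑ j : Fin B.length, ∑ i : Fin A.length,
          ∑ q : {xy : Fin (B.get j).length × Fin (A.get i).length // ((A.get i).get xy.2).1 = ((B.get j).get xy.1).1},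
            (g (A.eraseIdx i ++ (B.take j ++ LoopSeq.prune [Word.negMerge _ q.1.1 _ q.1.2] ++ B.drop (j + 1)))
              - g (A.eraseIdx i ++ (B.take j ++ LoopSeq.prune [Word.posMerge _ q.1.1 _ q.1.2] ++ B.drop (j + 1)))) :=
    ⟨fun A B g => _, fun _ _ _ => rfl⟩
  have SD0 : ∀ A, SD A (fun _ => 0) = 0 := fun A => by rw [hSD]; simp
  have SDsub : ∀ A (g h : LoopSeq d → ℝ), SD A (fun X => g X - h X) = SD A g - SD A h := by
    intro A g h; rw [hSD, hSD, hSD]; simp only [Finset.sum_sub_distrib]; ring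
  have SDadd : ∀ A (g h : LoopSeq d → ℝ), SD A (fun X => g X + h X) = SD A g + SD A h := by
    intro A g h; rw [hSD, hSD, hSD]; simp only [Finset.sum_add_distrib]; ring
  have SDmul : ∀ A (c : ℝ) (g : LoopSeq d → ℝ), SD A (fun X => c * g X) = c * SD A g := by
    intro A c g; rw [hSD, hSD]; simp only [← Finset.mul_sum]; ring
  have SDmul' : ∀ A (c : ℝ) (g : LoopSeq d → ℝ), SD A (fun X => g X * c) = SD A g * c := by
    intro A c g
    have h1 : (fun X => g X * c) = fun X => c * g X := by funext X; ring
    rw [h1, SDmul, mul_comm]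
  have SDnil : ∀ g : LoopSeq d → ℝ, SD [] g = 0 := by
    intro g
    rw [hSD]
    obtain ⟨h1, h2, h3, -⟩ := sums_nil (d := d) (R := ℝ)
    rw [h1, h2, h3, h3]; ring
  -- the slot functional `D_A g = |A| g(A) − 𝕊𝔻_A g`
  obtain ⟨Dsl, hDsl⟩ : ∃ Dsl : LoopSeq d → (LoopSeq d → ℝ) → ℝ, ∀ A g, Dsl A g = (A.len : ℝ) * g A - SD A g :=
    ⟨fun A g => _, fun _ _ => rfl⟩
  have Dadd : ∀ (A : LoopSeq d) (g g' : LoopSeq d → ℝ), Dsl A (fun X => g X + g' X) = Dsl A g + Dsl A g' := by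
    intro A g g'; rw [hDsl, hDsl, hDsl, SDadd]; ring
  have Dmul : ∀ (A : LoopSeq d) (c : ℝ) (g : LoopSeq d → ℝ), Dsl A (fun X => c * g X) = c * Dsl A g := by
    intro A c g; rw [hDsl, hDsl, SDmul]; ring
  -- the zeroth-order loop equation on the uncentered slot
  have Z0 : ∀ B₀ : LoopSeq d, IsLoopSeq B₀ → (B₀.len : ℝ) * F 2 β B₀ - SD B₀ (fun A => F 2 β A) = 0 := by
    intro B₀ hB₀
    by_cases h0 : B₀ = []
    · subst h0; rw [SDnil, LoopSeq.len_nil]; simp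
    have h := hrec 0 (Nat.zero_le K) B₀ hB₀ h0
    simp only [zero_add, hF1, hF0, mul_zero, Finset.sum_const_zero, sub_zero, add_zero] at h
    rw [hSD]
    linarith [h]
  -- ### facts from parts D–K and C
  have hvan := centered_coeff_vanish hCc hLc hF0 hF1 hrec hperm hnil hbd hβ P hP hG0 hGs
  have hnilG := centered_coeff_nil_mem hnil P hP hGs
  have hnilS : IsLoopSeq ([] : LoopSeq d) := fun l hl => by simp at hl
  set D : ℝ := 1 + (K + 1) * Cc with hD
  have hD1 : 1 ≤ D := by rw [hD]; nlinarith
  have hbdP : ∀ j, j ≤ K → ∀ u : LoopSeq d, IsLoopSeq u → |coeff j (P u)| ≤ Cc * Lc ^ u.len := by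
    intro j hj u hu; rw [hP]; exact hbd j hj u hu
  have apriori := centered_coeff_bound hCc hLc hbdP hG0 hGs
  -- the block covariance: null on empty blocks, exponentially bounded
  have hκl : ∀ X : LoopSeq d, κ [] X = 0 := fun X => by rw [hκ]; exact hnilG _ (by simp) _ 2 hK2
  have hκr : ∀ X : LoopSeq d, κ X [] = 0 := fun X => by rw [hκ]; exact hnilG _ (by simp) _ 2 hK2
  have hκbd : ∀ A B : LoopSeq d, IsLoopSeq A → IsLoopSeq B →
      |κ A B| ≤ Cc * D ^ 2 * Lc ^ A.len * Lc ^ B.len := by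
    intro A B hA hB
    rw [hκ]
    have h := apriori [A, B] (fun C hC => by
      simp only [List.mem_cons, List.mem_nil_iff, or_false] at hC
      rcases hC with rfl | rfl
      · exact hA
      · exact hB) [] hnilS 2 hK2
    simp only [List.length_cons, List.length_nil, List.map_cons, List.map_nil, List.sum_cons, List.sum_nil,
      LoopSeq.len_nil, zero_add, add_zero, pow_add] at h
    rw [← hD] at h
    linarith [h]
  -- ### induction on the number of centered blocks
  intro m
  induction m using Nat.strong_induction_on with
  | _ m ih =>
  intro hm
  -- the hafnian bound on lists of genuine blocks
  obtain ⟨Mh, hMh⟩ : ∃ Mh : ℝ, Mh = 1 + m * (Cc * D ^ 2) := ⟨_, rfl⟩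
  have hMh1 : 1 ≤ Mh := by
    have h : (0 : ℝ) ≤ m * (Cc * D ^ 2) := by positivity
    rw [hMh]; linarith
  have hHfbd : ∀ Cs : List (LoopSeq d), (∀ C ∈ Cs, IsLoopSeq C) → Cs.length = m →
      |Hf Cs (Finset.range m)| ≤ Mh ^ m * Lc ^ (Cs.map LoopSeq.len).sum := by
    intro Cs hCs hlen
    have h := hafnian_bound hH0 hHS Cs (c := Cc * D ^ 2) (M := Mh) (m := m) (w := fun i => Lc ^ (Cs.getD i []).len)
      (by positivity) hMh1 (by rw [hMh]; linarith) (fun i => one_le_pow₀ hLc) (Finset.range m)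
      (fun i hi j hj => by
        have hi' : i < Cs.length := by rw [hlen]; exact Finset.mem_range.mp hi
        have hj' : j < Cs.length := by rw [hlen]; exact Finset.mem_range.mp hj
        have h := hκbd _ _ (hCs _ (getD_mem' Cs hi' [])) (hCs _ (getD_mem' Cs hj' []))
        linarith [h])
      (Finset.range m) subset_rfl (by rw [Finset.card_range])
    rw [Finset.card_range, Finset.prod_pow_eq_pow_sum, ← hlen, sum_range_getD, hlen] at h
    exact h
  -- the unknown family: the Wick defect on `m`-block states
  set u : LoopSeq d → List (LoopSeq d) → ℝ :=
    fun B₀ Cs => if Cs.length = m then coeff m (G B₀ Cs) - F 2 β B₀ * Hf Cs (Finset.range m) else 0 with hu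
  have hzero := block_contraction (d := d) (β := β) (Mb := Cc * (1 + Mh ^ m)) (Lb := D * Lc) (by positivity) (by nlinarith)
    hβ SD hSD u ?_ ?_ ?_ ?_
  · intro B₀ Cs hB₀ hCs hlen
    have h := hzero B₀ Cs hB₀ hCs
    simp only [hu, if_pos hlen] at h
    linarith
  · -- ### a priori bound
    intro B₀ Cs hB₀ hCs
    have hpos : 0 ≤ Cc * (1 + Mh ^ m) * (D * Lc) ^ (B₀ ++ Cs.flatten).len := by positivity
    simp only [hu]
    split_ifs with hlen
    · by_cases hmem : [] ∈ Cs
      · obtain ⟨i, hi, hnull⟩ := exists_getD_eq' Cs [] hmem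
        rw [hnilG Cs hmem B₀ m hm, hafnian_eq_zero_of_null hHS _ Cs ⟨i, Finset.mem_range.mpr (hlen ▸ hi),
          fun X => by rw [hnull]; exact hκl X, fun X => by rw [hnull]; exact hκr X⟩]
        simpa using hpos
      have hCs' : ∀ C ∈ Cs, IsLoopSeq C ∧ C ≠ [] := fun C hC => ⟨hCs C hC, fun h => hmem (h ▸ hC)⟩
      have hml := length_le_sum_len Cs hCs'
      have h1 := apriori Cs hCs B₀ hB₀ m hm
      have h2 := hHfbd Cs hCs hlen
      have h3 := hbd 0 (Nat.zero_le K) B₀ hB₀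
      rw [LoopSeq.len_append, len_flatten, mul_pow]
      have hLcpow : 0 ≤ Lc ^ (B₀.len + (Cs.map LoopSeq.len).sum) := by positivity
      have hDpow : D ^ Cs.length ≤ D ^ (B₀.len + (Cs.map LoopSeq.len).sum) := pow_le_pow_right₀ hD1 (by omega)
      have hDpow1 : 1 ≤ D ^ (B₀.len + (Cs.map LoopSeq.len).sum) := one_le_pow₀ hD1
      calc |coeff m (G B₀ Cs) - F 2 β B₀ * Hf Cs (Finset.range m)|
          ≤ |coeff m (G B₀ Cs)| + |F 2 β B₀| * |Hf Cs (Finset.range m)| := by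
            rw [← abs_mul]; exact abs_sub _ _
        _ ≤ Cc * D ^ Cs.length * Lc ^ (B₀.len + (Cs.map LoopSeq.len).sum)
            + Cc * Lc ^ B₀.len * (Mh ^ m * Lc ^ (Cs.map LoopSeq.len).sum) :=
            add_le_add h1 (mul_le_mul h3 h2 (abs_nonneg _) (by positivity))
        _ = (Cc * D ^ Cs.length + Cc * Mh ^ m) * Lc ^ (B₀.len + (Cs.map LoopSeq.len).sum) := by rw [pow_add]; ring
        _ ≤ (Cc * D ^ (B₀.len + (Cs.map LoopSeq.len).sum) + Cc * Mh ^ m * D ^ (B₀.len + (Cs.map LoopSeq.len).sum))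
            * Lc ^ (B₀.len + (Cs.map LoopSeq.len).sum) := by
            refine mul_le_mul_of_nonneg_right ?_ hLcpow
            nlinarith [mul_le_mul_of_nonneg_left hDpow (by positivity : (0 : ℝ) ≤ Cc),
              mul_le_mul_of_nonneg_left hDpow1 (by positivity : (0 : ℝ) ≤ Cc * Mh ^ m)]
        _ = Cc * (1 + Mh ^ m) * (D ^ (B₀.len + (Cs.map LoopSeq.len).sum) * Lc ^ (B₀.len + (Cs.map LoopSeq.len).sum)) := by
            ring
    · simpa using hpos
  · -- ### empty blocks
    intro B₀ Cs hmem
    simp only [hu]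
    split_ifs with hlen
    · obtain ⟨i, hi, hnull⟩ := exists_getD_eq' Cs [] hmem
      rw [hnilG Cs hmem B₀ m hm, hafnian_eq_zero_of_null hHS _ Cs ⟨i, Finset.mem_range.mpr (hlen ▸ hi),
        fun X => by rw [hnull]; exact hκl X, fun X => by rw [hnull]; exact hκr X⟩, mul_zero, sub_self]
    · rfl
  · -- ### no blocks
    simp only [hu, List.length_nil]
    split_ifs with h0
    · rw [← h0, hG0, hP, Finset.range_zero, hH0, mul_one, sub_self]
    · rfl
  · -- ### the homogeneous equation for the Wick defect
    intro B₀ Cs hB₀ hCs' hflat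
    have hCs : ∀ C ∈ Cs, IsLoopSeq C := fun C hC => (hCs' C hC).1
    by_cases hlen : Cs.length = m
    · -- (a) the leading equation with its pair source, the source rewritten by induction
      have W1 := centered_coeff_leading_equation hCc hLc hF0 hF1 hrec hperm hnil hbd hβ P hP hG0 hGs SD XM hSD hXM m hm
        B₀ Cs hB₀ hCs' hlen
      have hlt : ∀ j : Fin Cs.length, (j : ℕ) < m := fun j => hlen ▸ j.isLt
      have SRC : (∑ j : Fin Cs.length, ∑ j' : Fin Cs.length, if (j : ℕ) < j' then
          coeff (m - 2) (G B₀ ((Cs.eraseIdx j').eraseIdx j)) * XM (Cs.get j) (Cs.get j') (fun M => F 2 β M) else 0) =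
          F 2 β B₀ * ∑ a ∈ Finset.range m, ∑ b ∈ Finset.range m, if a < b then
            XM (Cs.getD a []) (Cs.getD b []) (fun M => F 2 β M) * Hf Cs (((Finset.range m).erase a).erase b) else 0 := by
        rw [Finset.mul_sum, show Finset.range m = Finset.range Cs.length by rw [hlen],
          ← Fin.sum_univ_eq_sum_range (fun a => F 2 β B₀ * ∑ b ∈ Finset.range Cs.length, if a < b then
            XM (Cs.getD a []) (Cs.getD b []) (fun M => F 2 β M) * Hf Cs (((Finset.range Cs.length).erase a).erase b)
            else 0)]
        refine Finset.sum_congr rfl fun j _ => ?_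
        rw [Finset.mul_sum, ← Fin.sum_univ_eq_sum_range (fun b => F 2 β B₀ * if (j : ℕ) < b then
            XM (Cs.getD j []) (Cs.getD b []) (fun M => F 2 β M) * Hf Cs (((Finset.range Cs.length).erase j).erase b)
            else 0)]
        refine Finset.sum_congr rfl fun j' _ => ?_
        split_ifs with hjj
        · have hj' := j'.isLt
          have hlen2 : ((Cs.eraseIdx j').eraseIdx j).length = m - 2 := by
            rw [List.length_eraseIdx_of_lt (by rw [List.length_eraseIdx_of_lt hj']; omega), List.length_eraseIdx_of_lt hj']
            omega
          have hH := hafnian_eraseIdx_eraseIdx hH0 hHS Cs hjj hj'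
          rw [ih (m - 2) (by omega) (by omega) B₀ _ hB₀ (forall_mem_eraseIdx (forall_mem_eraseIdx hCs j') j) hlen2,
            show m - 2 = Cs.length - 2 by omega, hH, Finset.erase_right_comm, get_eq_getD' Cs j [],
            get_eq_getD' Cs j' []]
          ring
        · rw [mul_zero]
      -- (b) the slot operator on `f₀ ⊗ Hf`
      have SLOT : ((B₀.len + (Cs.map LoopSeq.len).sum : ℕ) : ℝ) * (F 2 β B₀ * Hf Cs (Finset.range m))
          - SD B₀ (fun A => F 2 β A * Hf Cs (Finset.range m))
          - ∑ j : Fin Cs.length, SD (Cs.get j) (fun C' => F 2 β B₀ * Hf (Cs.set j C') (Finset.range m)) =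
          F 2 β B₀ * ∑ a ∈ Finset.range m, ∑ b ∈ Finset.range m, if a < b then
            XM (Cs.getD a []) (Cs.getD b []) (fun M => F 2 β M) * Hf Cs (((Finset.range m).erase a).erase b) else 0 := by
        -- the centered slots: slot-Leibniz and the two-block identity
        have hlenlt : ∀ i ∈ Finset.range m, i < Cs.length := fun i hi => by rw [hlen]; exact Finset.mem_range.mp hi
        have LB := hafnian_slot_leibniz hH0 hHS Dsl Dadd Dmul (Finset.range m) Cs hlenlt
        have LB' : ∑ j ∈ Finset.range m, Dsl (Cs.getD j []) (fun C' => Hf (Cs.set j C') (Finset.range m)) =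
            ∑ a ∈ Finset.range m, ∑ b ∈ Finset.range m, if a < b then
              XM (Cs.getD a []) (Cs.getD b []) (fun M => F 2 β M) * Hf Cs (((Finset.range m).erase a).erase b) else 0 := by
          rw [LB]
          refine Finset.sum_congr rfl fun a ha => Finset.sum_congr rfl fun b hb => ?_
          split_ifs with hab
          · have ha' := hlenlt a ha
            have hb' := hlenlt b hb
            obtain ⟨hA, hA0⟩ := hCs' _ (getD_mem' Cs ha' [])
            obtain ⟨hB, hB0⟩ := hCs' _ (getD_mem' Cs hb' [])
            simp only [hDsl, hκ]
            rw [centered_two_block_identity hCc hLc hF0 hF1 hrec hperm hnil hbd hβ P hP hG0 hGs SD XM hSD hXM hK2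
              _ _ hA hB hA0 hB0]
          · rfl
        -- the slot sum in positional form
        have SUMD : ∑ j ∈ Finset.range m, Dsl (Cs.getD j []) (fun C' => Hf (Cs.set j C') (Finset.range m)) =
            (((Cs.map LoopSeq.len).sum : ℕ) : ℝ) * Hf Cs (Finset.range m)
              - ∑ j : Fin Cs.length, SD (Cs.get j) (fun C' => Hf (Cs.set j C') (Finset.range m)) := by
          have e1 : ∑ j ∈ Finset.range m, Dsl (Cs.getD j []) (fun C' => Hf (Cs.set j C') (Finset.range m)) =
              ∑ j ∈ Finset.range m, (((Cs.getD j []).len : ℝ) * Hf Cs (Finset.range m)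
                - SD (Cs.getD j []) (fun C' => Hf (Cs.set j C') (Finset.range m))) := by
            refine Finset.sum_congr rfl fun j hj => ?_
            rw [hDsl, set_getD_self' Cs (hlenlt j hj)]
          rw [e1, Finset.sum_sub_distrib, ← Finset.sum_mul, ← hlen, ← Nat.cast_sum, sum_range_getD,
            ← Fin.sum_univ_eq_sum_range (fun j => SD (Cs.getD j []) (fun C' => Hf (Cs.set j C') (Finset.range Cs.length)))]
          congr 1
          refine Finset.sum_congr rfl fun j _ => ?_
          rw [get_eq_getD' Cs j []]
        -- assemble
        have e2 : ∑ j : Fin Cs.length, SD (Cs.get j) (fun C' => F 2 β B₀ * Hf (Cs.set j C') (Finset.range m)) =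
            F 2 β B₀ * ∑ j : Fin Cs.length, SD (Cs.get j) (fun C' => Hf (Cs.set j C') (Finset.range m)) := by
          rw [Finset.mul_sum]
          refine Finset.sum_congr rfl fun j _ => ?_
          rw [SDmul]
        rw [e2, SDmul', ← LB', SUMD, Nat.cast_add]
        have z := Z0 B₀ hB₀
        linear_combination (Hf Cs (Finset.range m)) * z
      -- (c) the equation for the defect
      have e0 : u B₀ Cs = coeff m (G B₀ Cs) - F 2 β B₀ * Hf Cs (Finset.range m) := by simp only [hu, if_pos hlen]
      have e1 : (fun A => u A Cs) = fun A => coeff m (G A Cs) - F 2 β A * Hf Cs (Finset.range m) := by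
        funext A; simp only [hu, if_pos hlen]
      have e2 : ∀ j : Fin Cs.length, (fun C' => u B₀ (Cs.set j C')) =
          fun C' => coeff m (G B₀ (Cs.set j C')) - F 2 β B₀ * Hf (Cs.set j C') (Finset.range m) := by
        intro j; funext C'; simp only [hu, List.length_set, if_pos hlen]
      rw [e0, e1, Finset.sum_congr rfl fun j _ => by rw [e2 j], SDsub,
        Finset.sum_congr rfl fun j _ => by rw [SDsub], Finset.sum_sub_distrib]
      rw [SRC] at W1
      rw [LoopSeq.len_append, len_flatten]
      linear_combination W1 - SLOT
    · -- another number of blocks: everything is zero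
      have e0 : u B₀ Cs = 0 := by simp only [hu, if_neg hlen]
      have e1 : (fun A => u A Cs) = fun _ => 0 := by funext A; simp only [hu, if_neg hlen]
      have e2 : ∀ j : Fin Cs.length, (fun C' => u B₀ (Cs.set j C')) = fun _ => 0 := by
        intro j; funext C'; simp only [hu, List.length_set, if_neg hlen]
      rw [e0, e1, Finset.sum_congr rfl fun j _ => by rw [e2 j], SD0, Finset.sum_congr rfl fun j _ => SD0 _]
      simp

end setting

end StringDuality

end Summit.QuantumFields.GaugeBoot

end
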